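import Literature.AlgebraicTopology.SingularHomology.ProductKunneth
import HarnessLib

/-!
# The Künneth theorem for `M × N`: graded bases of `H*(N; R)` and field coefficients

Companion of `ProductKunneth` (A. Hatcher, *Algebraic Topology* (2002), §3.2 Thm. 3.16 via the
Leray–Hirsch theorem 4D.1 for `pr₁ : M × N → M`). That file proves the bijectivity of
`θ : Π_{d j ≤ k} Hᵏ⁻ᵈʲ(M; R) → Hᵏ(M × N; R)`, `(aⱼ) ↦ Σⱼ pr₁^* aⱼ ⌣ pr₂^* eⱼ`, for classes
`eⱼ ∈ H^{d j}(N; R)` that form a GRADED BASIS in the Leray–Hirsch sense (bijectivity of `θ` over the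
one-point base). Here:

* `LerayHirsch.bijective_lhMap_const_of_basis` — the graded-basis condition from honest bases: if
  `v k i` (`i : σ k`) is a basis of `Hᵏ(N; R)` for `k ≤ D` and `Hᵏ(N; R) = 0` for `k > D`, the
  family `e ⟨k, i⟩ = v k i` satisfies it (over a point only the components of degree `k - d j = 0`
  survive, `H⁰(pt; R) = R · 1`, `Hᵐ(pt; R) = 0` for `m > 0`, and `1 ⌣ e = e`);
* `LerayHirsch.mem_span_cupProduct_fst_snd_of_finite` — **Künneth over a field, spanning form**: if
  `Hᵏ(N; F)` is finite-dimensional for all `k` and zero for `k > D`, and `M` is a paracompact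
  Hausdorff space with an atlas on a second-countable real normed space, every class of
  `Hᵏ(M × N; F)` is an `F`-linear combination of cross products `pr₁^* a ⌣ pr₂^* b`.

Everything is proved; no named facts.

## References

* [HatcherAT2002] A. Hatcher, *Algebraic Topology*, CUP 2002, §3.1 p. 199, §3.2 Thm. 3.16, §4.D Thm. 4D.1.
* [HusemollerFibreBundles1994] D. Husemoller, *Fibre Bundles*, 3rd ed. (1994), Ch. 17 §1 Thm. 1.1.
-/

noncomputable section

open CategoryTheory Function Set

namespace Literature.AlgebraicTopology.SingularHomology

namespace LerayHirsch

variable (R : Type) [CommRing R] {N : Type} [TopologicalSpace N]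

/-! ### Graded bases: the comparison map over a point -/

section Point

/-- `Hᵐ(pt; R) = 0` for `m ≠ 0`. [cite: HatcherAT2002, §3.1 p. 199] -/
theorem punit_eq_zero_of_ne {m : ℕ} (hm : m ≠ 0) (x : singularCohomology R R PUnit.{1} m) : x = 0 :=
  ModuleCat.eq_zero_of_isZero_obj
    (singularCochainComplex.isZero_singularCohomology_of_subsingleton' (R := R) (M := R) hm) x

/-- Every class of `H⁰(pt; R)` is `r • 1`. [cite: HatcherAT2002, §3.1 p. 199] -/
theorem exists_eq_smul_one_punit (x : singularCohomology R R PUnit.{1} 0) :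
    ∃ r : R, x = r • singularCohomology.one R PUnit.{1} := by
  obtain ⟨r, rfl⟩ := exists_eq_constClass_punit R R x
  exact ⟨r, constClass_eq_smul_one R PUnit.{1} r⟩

/-- **Graded bases.** Let `v k i ∈ Hᵏ(N; R)` (`k ≤ D`, `i : σ k`, finitely many) be a basis of
`Hᵏ(N; R)` for each `k ≤ D` — `r ↦ Σᵢ rᵢ • v k i` bijective — and `Hᵏ(N; R) = 0` for `k > D`. Then
the family `e ⟨k, i⟩ = v k i`, indexed by `Σ k, σ k` with degrees `k`, is a graded basis in the
Leray–Hirsch sense: over the one-point base the comparison map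
`(aⱼ) ↦ Σⱼ aⱼ ⌣ eⱼ : Π_{d j ≤ k} Hᵏ⁻ᵈʲ(pt) → Hᵏ(N)` is bijective for every `k` (only the components
of degree `k - d j = 0` survive, `H⁰(pt; R) = R · 1`, and `1 ⌣ e = e`).
[cite: HatcherAT2002, §3.2 Thm. 3.16 (hypothesis) and §3.1 p. 199] -/
theorem bijective_lhMap_const_of_basis {D : ℕ} {σ : Fin (D + 1) → Type} [∀ k, Fintype (σ k)]
    (v : (k : Fin (D + 1)) → σ k → singularCohomology R R N k)
    (hv : ∀ k, Bijective fun r : σ k → R ↦ ∑ i, r i • v k i)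
    (hD : ∀ k, D < k → Subsingleton (singularCohomology R R N k)) (k : ℕ) :
    Bijective (lhMap R (fun j : (Σ k, σ k) ↦ (j.1 : ℕ)) (ContinuousMap.const N PUnit.unit : C(N, PUnit.{1}))
      (fun j ↦ v j.1 j.2) k) := by
  classical
  set d : (Σ k, σ k) → ℕ := fun j ↦ (j.1 : ℕ)
  set q : C(N, PUnit.{1}) := ContinuousMap.const N PUnit.unit
  -- components of positive degree vanish
  have hvan : ∀ (a : Src R d PUnit.{1} k) (j : Idx d k), d j.1 ≠ k → a j = 0 := fun a j hj ↦
    punit_eq_zero_of_ne R (by have := j.2; omega) (a j)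
  by_cases hk : k ≤ D
  swap
  · -- above `D`: source and target vanish
    haveI := hD k (not_le.1 hk)
    have hsrc : ∀ a : Src R d PUnit.{1} k, a = 0 := fun a ↦ funext fun j ↦ hvan a j (by
      have := j.1.1.2; change (j.1.1 : ℕ) ≠ k; omega)
    refine ⟨fun a a' _ ↦ by rw [hsrc a, hsrc a'], fun z ↦ ⟨0, Subsingleton.elim _ _⟩⟩
  -- the degree-`k` index and the surviving components
  let kf : Fin (D + 1) := ⟨k, Nat.lt_succ_of_le hk⟩
  -- uniform constants `cst m r ∈ Hᵐ(pt)`: `r • 1` in degree `0`, `0` above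
  let cst : (m : ℕ) → R → singularCohomology R R PUnit.{1} m := fun m ↦
    match m with
    | 0 => fun r ↦ r • singularCohomology.one R PUnit.{1}
    | _ + 1 => fun _ ↦ 0
  have hcst_ex : ∀ m, m = 0 → ∀ x : singularCohomology R R PUnit.{1} m, ∃ r, x = cst m r := by
    rintro m rfl x
    exact exists_eq_smul_one_punit R x
  have hcst_zero : ∀ m, cst m 0 = 0 := by
    rintro (_ | m)
    · exact zero_smul R _
    · rfl
  have hcst_cup : ∀ (m p n : ℕ) (h : m + p = n) (hm : m = 0) (hp : p = n) (r : R) (y : singularCohomology R R N p),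
      cupProduct h (singularCohomology.map R R q m (cst m r)) y = hp ▸ (r • y) := by
    rintro m p n h rfl rfl r y
    change cupProduct h (singularCohomology.map R R q 0 (r • singularCohomology.one R PUnit.{1})) y = r • y
    rw [map_smul, singularCohomology.map_one, LinearMap.map_smul₂, one_cupProduct]
  -- the comparison map only sees the degree-`k` components
  have hθ : ∀ a : Src R d PUnit.{1} k, lhMap R d q (fun j ↦ v j.1 j.2) k a =
      ∑ i : σ kf, cupProduct (show (k - k) + k = k by omega)
        (singularCohomology.map R R q (k - k) (a ⟨⟨kf, i⟩, le_rfl⟩)) (v kf i) := by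
    intro a
    rw [lhMap_apply, Fintype.sum_sigma, Finset.sum_eq_single kf]
    · refine Finset.sum_congr rfl fun i _ ↦ ?_
      rw [dif_pos (show d ⟨kf, i⟩ ≤ k from le_rfl)]
    · intro k' _ hk'
      refine Finset.sum_eq_zero fun i _ ↦ ?_
      split_ifs with h
      · rw [hvan a ⟨⟨k', i⟩, h⟩ (fun h' ↦ hk' (Fin.ext h')), map_zero, LinearMap.map_zero₂]
      · rfl
    · exact fun h ↦ absurd (Finset.mem_univ kf) h
  constructor
  · -- injectivity
    refine (injective_iff_map_eq_zero _).2 fun a ha ↦ ?_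
    have hex : ∀ i : σ kf, ∃ r : R, a ⟨⟨kf, i⟩, le_rfl⟩ = cst (k - k) r := fun i ↦
      hcst_ex (k - k) (Nat.sub_self k) _
    choose r hr using hex
    have hsum : ∑ i, r i • v kf i = 0 := by
      rw [hθ] at ha
      rw [← ha]
      refine Finset.sum_congr rfl fun i _ ↦ ?_
      rw [hr i, hcst_cup (k - k) k k _ (Nat.sub_self k) rfl]
    have hr0 : r = 0 := (hv kf).1 (by
      change ∑ i, r i • v kf i = ∑ i, (0 : σ kf → R) i • v kf i
      rw [hsum]
      exact (Finset.sum_eq_zero fun i _ ↦ zero_smul R _).symm)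
    funext j
    obtain ⟨⟨k', i⟩, hj⟩ := j
    by_cases hk' : k' = kf
    · subst hk'
      change a ⟨⟨kf, i⟩, le_rfl⟩ = 0
      rw [hr i, hr0, Pi.zero_apply, hcst_zero]
    · exact hvan a ⟨⟨k', i⟩, hj⟩ fun h' ↦ hk' (Fin.ext h')
  · -- surjectivity
    intro z
    obtain ⟨r, hrz⟩ := (hv kf).2 z
    refine ⟨fun j ↦ if hj : j.1.1 = kf then cst (k - d j.1) (r (hj ▸ j.1.2)) else 0, ?_⟩
    rw [hθ, ← hrz]
    refine Finset.sum_congr rfl fun i _ ↦ ?_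
    rw [dif_pos rfl]
    exact hcst_cup (k - k) k k _ (Nat.sub_self k) rfl (r i) (v kf i)

end Point

/-! ### Field coefficients -/

section Field

variable (F : Type) [Field F] {N : Type} [TopologicalSpace N]
variable (E : Type) [NormedAddCommGroup E] [NormedSpace ℝ E] [SecondCountableTopology E]
variable {M : Type} [TopologicalSpace M] [T2Space M] [ParacompactSpace M] [ChartedSpace E M]

include E in
/-- **Künneth over a field, spanning form.** If `Hᵏ(N; F)` is finite-dimensional for every `k` and
vanishes for `k > D`, and `M` is a paracompact Hausdorff space with an atlas modelled on a
second-countable real normed space, then every class of `Hᵏ(M × N; F)` is an `F`-linear combination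
of cross products `pr₁^* a ⌣ pr₂^* b` (`a ∈ Hⁱ(M; F)`, `b ∈ Hʲ(N; F)`, `i + j = k`): bases of the
`Hᵏ(N; F)`, `k ≤ D`, form a graded basis (`bijective_lhMap_const_of_basis`), and
`bijective_lhMap_fst_prod` applies. [cite: HatcherAT2002, §3.2 Thm. 3.16] -/
theorem mem_span_cupProduct_fst_snd_of_finite {D : ℕ} (hfin : ∀ k, Module.Finite F (singularCohomology F F N k))
    (hD : ∀ k, D < k → Subsingleton (singularCohomology F F N k)) (k : ℕ) (z : singularCohomology F F (M × N) k) :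
    z ∈ Submodule.span F {v | ∃ (i j : ℕ) (h : i + j = k) (a : singularCohomology F F M i) (b : singularCohomology F F N j),
      v = cupProduct h (singularCohomology.map F F (ContinuousMap.fst : C(M × N, M)) i a)
        (singularCohomology.map F F (ContinuousMap.snd : C(M × N, N)) j b)} := by
  haveI := hfin
  let v : (k : Fin (D + 1)) → Fin (Module.finrank F (singularCohomology F F N k)) → singularCohomology F F N k :=
    fun k ↦ Module.finBasis F (singularCohomology F F N k)
  have hv : ∀ k : Fin (D + 1), Bijective fun r : Fin (Module.finrank F (singularCohomology F F N k)) → F ↦ ∑ i, r i • v k i := by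
    intro k
    have : (fun r : Fin (Module.finrank F (singularCohomology F F N k)) → F ↦ ∑ i, r i • v k i) =
        (Module.finBasis F (singularCohomology F F N k)).equivFun.symm :=
      funext fun r ↦ ((Module.finBasis F (singularCohomology F F N k)).equivFun_symm_apply r).symm
    rw [this]
    exact (Module.finBasis F (singularCohomology F F N k)).equivFun.symm.bijective
  exact mem_span_cupProduct_fst_snd F (fun j : (Σ k : Fin (D + 1), Fin (Module.finrank F (singularCohomology F F N k))) ↦ (j.1 : ℕ))
    (fun j ↦ v j.1 j.2) E (bijective_lhMap_const_of_basis F v hv hD) k z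

end Field

end LerayHirsch

end Literature.AlgebraicTopology.SingularHomology

end
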